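import Literature.Probability.Process.ContinuousHitting
import HarnessLib

/-!
# Hitting times of closed sets after a stopping time (continuous adapted processes)

Topic `Probability/Process`. For a process `u : ℝ≥0 → Ω → E` with everywhere-continuous paths in a
(pseudo)metric space, adapted to a raw filtration `f`, a closed set `s ⊆ E` and a random time
`T : Ω → WithTop ℝ≥0`, the **first hitting time of `s` at or after `T`**,

  `hittingFrom u s T ω = inf {j : ℝ≥0 | T ω ≤ j, u j ω ∈ s}`   (`⊤` if there is no such `j`),

is a stopping time of `f` as soon as `T` is one (`Literature.Probability.Process.isStoppingTime_hittingFrom`):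
`{τ ≤ i} = ⋂ₙ ⋃_{q ∈ D ∪ {i}} ({T ≤ q} ∩ {infDist (u q) s < 1/(n+1)})` for a countable dense
`D ⊆ [0, i]` (continuity of paths, compactness of `[0, i]`, closedness of `s` and of `{T ≤ ·}`),
exactly as for `T = 0` (`isStoppingTime_hittingAfter_of_continuous`, Revuz–Yor (1999), Ch. I,
Prop. (4.6)); and the elementary API: the infimum is attained
(`Literature.Probability.Process.mem_of_hittingFrom_eq_coe`), `T ≤ τ`, the path avoids `s` on `[T, τ)`,
`τ ≤ j` for every visit `j ≥ T`. These are the successive passage times "after `T`" of strong-Markov-free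
optional-stopping arguments (used for the level crossings of the SLE slope diffusion in
`RandomPlanarGeometry/SLEOnePointUpperEstimate.lean`).

Mathlib's `MeasureTheory.hittingAfter u s n` is the case of a deterministic lower bound `n`; a random
`T` is not covered (searched `hittingAfter`, `hittingBtwn`, `IsStoppingTime`).

## References

* D. Revuz, M. Yor, *Continuous Martingales and Brownian Motion* (3rd ed., 1999), Ch. I, §4,
  Prop. (4.6) and Exercise (4.19).
-/

noncomputable section

open MeasureTheory Filter Topology Set Metric
open scoped NNReal

namespace Literature.Probability.Process

variable {Ω E : Type*} {mΩ : MeasurableSpace Ω}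

open Classical in
/-- **The first hitting time of `s` at or after the random time `T`**: the infimum of the times
`j ≥ T ω` with `u j ω ∈ s`, as an element of `WithTop ℝ≥0` (`⊤` if there is none).
Revuz–Yor (1999), Ch. I, §4. [folklore] -/
def hittingFrom (u : ℝ≥0 → Ω → E) (s : Set E) (T : Ω → WithTop ℝ≥0) (ω : Ω) : WithTop ℝ≥0 :=
  if ∃ j : ℝ≥0, T ω ≤ j ∧ u j ω ∈ s then
    ((sInf {j : ℝ≥0 | T ω ≤ j ∧ u j ω ∈ s} : ℝ≥0) : WithTop ℝ≥0) else ⊤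

section Basic

variable {u : ℝ≥0 → Ω → E} {s : Set E} {T : Ω → WithTop ℝ≥0} {ω : Ω}

/-- If the path visits `s` at some time `≥ T`, the hitting time is the (coerced) infimum of these
times. [folklore] -/
theorem hittingFrom_apply_of_exists (h : ∃ j : ℝ≥0, T ω ≤ j ∧ u j ω ∈ s) :
    hittingFrom u s T ω = ((sInf {j : ℝ≥0 | T ω ≤ j ∧ u j ω ∈ s} : ℝ≥0) : WithTop ℝ≥0) := by
  rw [hittingFrom, if_pos h]

/-- If the path never visits `s` at a time `≥ T`, the hitting time is `⊤`. [folklore] -/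
theorem hittingFrom_apply_of_forall (h : ∀ j : ℝ≥0, T ω ≤ j → u j ω ∉ s) :
    hittingFrom u s T ω = ⊤ := by
  rw [hittingFrom, if_neg (not_exists.2 fun j hj ↦ h j hj.1 hj.2)]

/-- The hitting time is finite iff the path visits `s` at some time `≥ T`. [folklore] -/
theorem hittingFrom_ne_top_iff : hittingFrom u s T ω ≠ ⊤ ↔ ∃ j : ℝ≥0, T ω ≤ j ∧ u j ω ∈ s := by
  constructor
  · intro h
    by_contra hne
    exact h (hittingFrom_apply_of_forall fun j hj hs ↦ hne ⟨j, hj, hs⟩)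
  · intro hex
    rw [hittingFrom_apply_of_exists hex]
    exact WithTop.coe_ne_top

/-- A visit of `s` at a time `j ≥ T` bounds the hitting time: `τ ≤ j`. [folklore] -/
theorem hittingFrom_le_of_mem {j : ℝ≥0} (hT : T ω ≤ j) (hj : u j ω ∈ s) :
    hittingFrom u s T ω ≤ j := by
  rw [hittingFrom_apply_of_exists ⟨j, hT, hj⟩, WithTop.coe_le_coe]
  exact csInf_le (OrderBot.bddBelow _) ⟨hT, hj⟩

/-- **`T ≤ τ`.** [folklore] -/
theorem le_hittingFrom : T ω ≤ hittingFrom u s T ω := by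
  by_cases h : ∃ j : ℝ≥0, T ω ≤ j ∧ u j ω ∈ s
  · rw [hittingFrom_apply_of_exists h]
    obtain ⟨j, hj, hjs⟩ := h
    obtain ⟨t₀, ht₀⟩ : ∃ t₀ : ℝ≥0, T ω = t₀ :=
      Option.ne_none_iff_exists'.1 (ne_top_of_le_ne_top WithTop.coe_ne_top hj)
    rw [ht₀, WithTop.coe_le_coe]
    exact le_csInf ⟨j, ht₀ ▸ hj, hjs⟩ fun b hb ↦ WithTop.coe_le_coe.1 hb.1
  · rw [hittingFrom, if_neg h]
    exact le_top

/-- On `[T, τ)` the path is outside `s`. [folklore] -/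
theorem notMem_of_lt_hittingFrom {t : ℝ≥0} (hT : T ω ≤ t)
    (h : (t : WithTop ℝ≥0) < hittingFrom u s T ω) : u t ω ∉ s :=
  fun hs ↦ absurd (hittingFrom_le_of_mem hT hs) (not_le.2 h)

end Basic

section Closed

variable [TopologicalSpace E] {u : ℝ≥0 → Ω → E} {s : Set E} {T : Ω → WithTop ℝ≥0} {ω : Ω}

/-- **The infimum is attained** (closed set, continuous path): if `τ = τ₀ < ⊤` then `u τ₀ ω ∈ s`
(and `T ≤ τ₀`, `le_hittingFrom`). Revuz–Yor (1999), Ch. I, §4. [folklore] -/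
theorem mem_of_hittingFrom_eq_coe (hs : IsClosed s) (hc : Continuous fun t ↦ u t ω)
    {τ₀ : ℝ≥0} (hτ : hittingFrom u s T ω = τ₀) : u τ₀ ω ∈ s := by
  have hex : ∃ j : ℝ≥0, T ω ≤ j ∧ u j ω ∈ s :=
    hittingFrom_ne_top_iff.1 (by rw [hτ]; exact WithTop.coe_ne_top)
  rw [hittingFrom_apply_of_exists hex, WithTop.coe_eq_coe] at hτ
  have hclosed : IsClosed {j : ℝ≥0 | T ω ≤ j ∧ u j ω ∈ s} := by
    have h1 : IsClosed {j : ℝ≥0 | T ω ≤ (j : WithTop ℝ≥0)} :=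
      isClosed_le continuous_const WithTop.continuous_coe
    exact h1.inter (hs.preimage hc)
  have hmem := hclosed.csInf_mem hex (OrderBot.bddBelow _)
  rw [hτ] at hmem
  exact hmem.2

/-- `{τ ≤ i}` is "the path visits `s` at some time in `[T, i]`" (closed set, continuous path).
[folklore] -/
theorem hittingFrom_le_coe_iff (hs : IsClosed s) (hc : Continuous fun t ↦ u t ω) {i : ℝ≥0} :
    hittingFrom u s T ω ≤ i ↔ ∃ j ≤ i, T ω ≤ j ∧ u j ω ∈ s := by
  constructor
  · intro hle
    have hne : hittingFrom u s T ω ≠ ⊤ := ne_top_of_le_ne_top WithTop.coe_ne_top hle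
    obtain ⟨τ₀, hτ₀⟩ := WithTop.ne_top_iff_exists.1 hne
    refine ⟨τ₀, ?_, ?_, mem_of_hittingFrom_eq_coe hs hc hτ₀.symm⟩
    · rw [← hτ₀] at hle
      exact WithTop.coe_le_coe.1 hle
    · have := le_hittingFrom (u := u) (s := s) (T := T) (ω := ω)
      rwa [← hτ₀] at this
  · rintro ⟨j, hji, hTj, hj⟩
    exact (hittingFrom_le_of_mem hTj hj).trans (WithTop.coe_le_coe.2 hji)

end Closed

section Metric

variable [PseudoMetricSpace E] {u : ℝ≥0 → Ω → E} {s : Set E} {T : Ω → WithTop ℝ≥0} {ω : Ω}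

/-- The event `{τ ≤ i}` described countably: for `s` nonempty closed, a continuous path, and
`D ⊆ [0, i]` dense, the path visits `s` at a time in `[T, i]` iff for every `n` some
`q ∈ D ∪ {i}` has `T ≤ q` and `infDist (u q ω) s < 1/(n+1)`. (`⇒`: if the visit is at `j < i`,
density and right-continuity at `j`; if at `j = i`, take `q = i`. `⇐`: compactness of `[0, i]`,
closedness of `s` and of `{T ≤ ·}`.) Revuz–Yor (1999), Ch. I, §4, proof of Prop. (4.6). [folklore] -/
theorem exists_mem_Icc_mem_iff_forall_exists_infDist_lt (hs : IsClosed s) (hne : s.Nonempty)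
    (hc : Continuous fun t ↦ u t ω) {i : ℝ≥0} {D : Set (Iic i)} (hD : Dense D) :
    (∃ j ≤ i, T ω ≤ j ∧ u j ω ∈ s) ↔
      ∀ n : ℕ, ∃ q ∈ insert (⟨i, mem_Iic.2 le_rfl⟩ : Iic i) D, T ω ≤ ((q : ℝ≥0) : WithTop ℝ≥0) ∧
        infDist (u (q : ℝ≥0) ω) s < 1 / ((n : ℝ) + 1) := by
  constructor
  · rintro ⟨j, hji, hTj, hj⟩ n
    have hj0 : infDist (u j ω) s = 0 := infDist_zero_of_mem hj
    rcases hji.lt_or_eq with hlt | rfl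
    · -- `j < i`: a point of `D` slightly to the right of `j`
      have hcont : Continuous fun q : Iic i ↦ infDist (u (q : ℝ≥0) ω) s :=
        ((continuous_infDist_pt s).comp hc).comp continuous_subtype_val
      have hopen : IsOpen {q : Iic i | infDist (u (q : ℝ≥0) ω) s < 1 / ((n : ℝ) + 1) ∧
          j < (q : ℝ≥0)} :=
        (isOpen_lt hcont continuous_const).inter
          (isOpen_lt continuous_const (NNReal.continuous_coe.comp continuous_subtype_val))
      -- it is nonempty: by continuity at `j` within `(j, i]`
      have hnonempty : ∃ q : Iic i, q ∈ {q : Iic i | infDist (u (q : ℝ≥0) ω) s <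
          1 / ((n : ℝ) + 1) ∧ j < (q : ℝ≥0)} := by
        have h1 : ∀ᶠ t in 𝓝 j, infDist (u t ω) s < 1 / ((n : ℝ) + 1) := by
          have hct : ContinuousAt (fun t ↦ infDist (u t ω) s) j :=
            ((continuous_infDist_pt s).comp hc).continuousAt
          refine hct.eventually (gt_mem_nhds ?_)
          show infDist (u j ω) s < 1 / ((n : ℝ) + 1)
          rw [hj0]; positivity
        have h2 : ∀ᶠ t in 𝓝[>] j, infDist (u t ω) s < 1 / ((n : ℝ) + 1) ∧ t ∈ Ioc j i := by
          have h1' : ∀ᶠ t in 𝓝[>] j, infDist (u t ω) s < 1 / ((n : ℝ) + 1) :=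
            nhdsWithin_le_nhds h1
          exact h1'.and (Ioc_mem_nhdsGT hlt)
        obtain ⟨t, ht1, ht2⟩ := h2.exists
        exact ⟨⟨t, ht2.2⟩, ht1, ht2.1⟩
      obtain ⟨q, hq1, hq2⟩ := hD.inter_open_nonempty _ hopen hnonempty
      refine ⟨q, mem_insert_of_mem _ hq2, ?_, hq1.1⟩
      have hjq : j < (q : ℝ≥0) := hq1.2
      exact hTj.trans (WithTop.coe_le_coe.2 hjq.le)
    · exact ⟨⟨j, mem_Iic.2 le_rfl⟩, mem_insert _ _, hTj, by rw [hj0]; positivity⟩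
  · intro h
    choose q _ hTq hq using h
    obtain ⟨a, ha, φ, hφ, hlim⟩ := (isCompact_Icc (a := (0 : ℝ≥0)) (b := i)).tendsto_subseq
      (x := fun n ↦ ((q n : Iic i) : ℝ≥0)) fun n ↦ ⟨bot_le, (q n).2⟩
    refine ⟨a, ha.2, ?_, ?_⟩
    · have hclosed : IsClosed {t : ℝ≥0 | T ω ≤ (t : WithTop ℝ≥0)} :=
        isClosed_le continuous_const WithTop.continuous_coe
      exact hclosed.mem_of_tendsto hlim (Eventually.of_forall fun n ↦ hTq (φ n))
    · have hcont : Continuous fun t ↦ infDist (u t ω) s := (continuous_infDist_pt s).comp hc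
      have h1 : Tendsto (fun n ↦ infDist (u ((q (φ n) : Iic i) : ℝ≥0) ω) s) atTop
          (𝓝 (infDist (u a ω) s)) := (hcont.tendsto a).comp hlim
      have h2 : Tendsto (fun n ↦ infDist (u ((q (φ n) : Iic i) : ℝ≥0) ω) s) atTop (𝓝 0) := by
        refine squeeze_zero (fun n ↦ infDist_nonneg) (fun n ↦ (hq (φ n)).le) ?_
        have h3 : Tendsto (fun n : ℕ ↦ 1 / ((n : ℝ) + 1)) atTop (𝓝 0) :=
          tendsto_one_div_add_atTop_nhds_zero_nat
        exact h3.comp hφ.tendsto_atTop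
      have h0 : infDist (u a ω) s = 0 := tendsto_nhds_unique h1 h2
      exact (hs.mem_iff_infDist_zero hne).2 h0

variable [MeasurableSpace E] [OpensMeasurableSpace E]

/-- **The hitting time of a closed set after a stopping time is a stopping time** (continuous
adapted process, raw filtration): `{τ ≤ i} ∈ f i` by the countable description
`exists_mem_Icc_mem_iff_forall_exists_infDist_lt`, the events `{T ≤ q}` (`q ≤ i`) being in
`f q ≤ f i`. Revuz–Yor, *Continuous Martingales and Brownian Motion* (1999), Ch. I, §4,
Prop. (4.6) (the case `T = 0`) and Exercise (4.19). [cite: RevuzYor1999, Ch. I Prop. (4.6)] -/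
theorem isStoppingTime_hittingFrom {f : Filtration ℝ≥0 mΩ} (hu : Adapted f u)
    (hc : ∀ ω, Continuous fun t ↦ u t ω) (hs : IsClosed s) (hT : IsStoppingTime f T) :
    IsStoppingTime f (hittingFrom u s T) := by
  intro i
  have hset : {ω | hittingFrom u s T ω ≤ i} = {ω | ∃ j ≤ i, T ω ≤ j ∧ u j ω ∈ s} := by
    ext ω
    exact hittingFrom_le_coe_iff hs (hc ω)
  rw [hset]
  rcases s.eq_empty_or_nonempty with rfl | hne
  · simp
  obtain ⟨D, hDc, hDd⟩ := TopologicalSpace.exists_countable_dense (Iic i)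
  have key : {ω | ∃ j ≤ i, T ω ≤ j ∧ u j ω ∈ s} =
      ⋂ n : ℕ, ⋃ q ∈ insert (⟨i, mem_Iic.2 le_rfl⟩ : Iic i) D,
        {ω | T ω ≤ ((q : ℝ≥0) : WithTop ℝ≥0)} ∩
          {ω | infDist (u (q : ℝ≥0) ω) s < 1 / ((n : ℝ) + 1)} := by
    ext ω
    rw [mem_setOf_eq, exists_mem_Icc_mem_iff_forall_exists_infDist_lt hs hne (hc ω) hDd]
    simp only [mem_iInter, mem_iUnion, mem_setOf_eq, exists_prop, mem_inter_iff]
  rw [key]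
  refine MeasurableSet.iInter fun n ↦ MeasurableSet.biUnion (hDc.insert _) fun q _ ↦ ?_
  have hm : Measurable[f i] (u (q : ℝ≥0)) := (hu (q : ℝ≥0)).mono (f.mono q.2) le_rfl
  refine MeasurableSet.inter ?_
    (measurableSet_lt ((continuous_infDist_pt s).measurable.comp hm) measurable_const)
  exact f.mono q.2 _ (hT.measurableSet_le (q : ℝ≥0))

end Metric

end Literature.Probability.Process
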